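import Summits.HodgeConjecture.HodgeConjecture.Theses.SiuRepresentability
import Literature.AlgebraicGeometry.HodgeTheory.LefschetzOneOneHolds

/-!
# Route SiuRepresentability — `KaehlerRepresentableOfSectors` (glue item stmt-HodgeConjecture-18537)

`IndecomposableRepresentable → RepresentableCupHodge → KaehlerRepresentable`: on a ball quotient,
every rational `(p,p)`-class (`2 ≤ p ≤ n/2`) is a combination of representable classes and of cup
products `a ∪ b` of rational Hodge classes of positive codimensions `i + j = p`
(`IndecomposableRepresentable`); a cup product `a ∪ b` with `a` algebraic or representable lies in the
span of the representable classes (`RepresentableCupHodge`).  By strong induction on `p`: for `i = 1`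
the factor `a` is algebraic by the Lefschetz theorem on `(1,1)`-classes (a THEOREM of the tree,
`lefschetzOneOne_rational_holds`); for `i ≥ 2` it is a combination of representable classes by the
induction hypothesis, and `a ↦ a ∪ b` is linear (`cupProduct` is bilinear), so `Submodule.map_span_le`
reduces to the generators.  No named-fact hypothesis, no sorry.
-/

-- `Summit.HodgeConjecture.HodgeConjecture.Theorems` is the mandated namespace (single-problem
-- summit: Problem = Summit), which `linter.dupNamespace` flags on every declaration; the lakefile
-- turns the linter off tree-wide (weak option), restated here so stand-alone elaboration is
-- warning-free too.
set_option linter.dupNamespace false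

namespace Summit.HodgeConjecture.HodgeConjecture.Theorems

open Literature.AlgebraicGeometry.Motives Literature.AlgebraicGeometry.HodgeTheory
  Literature.AlgebraicTopology.SingularHomology

/-- **Item stmt-HodgeConjecture-18537 (`KaehlerRepresentableOfSectors`), route `SiuRepresentability`**:
strong induction on the codimension; decomposable generators `a ∪ b` are sent into the representable
span by `RepresentableCupHodge`, the factor `a` being algebraic (`i = 1`, Lefschetz `(1,1)`) or, by
induction and linearity of `· ∪ b`, a combination of representable classes. [cite: Siu1980, Thm. 1]
[cite: VoisinHodgeI2002, Thm. 11.30] -/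
theorem siuRepresentability_kaehlerRepresentableOfSectors_proof :
    Summit.HodgeConjecture.HodgeConjecture.Theses.SiuRepresentability.KaehlerRepresentableOfSectors := by
  intro hIR hRCH n X hX hB p
  induction p using Nat.strong_induction_on with
  | _ p ih =>
  intro k hpk hp2 h2p c hc hpp
  refine Submodule.span_le.2 ?_ (hIR hX hB p k hpk hp2 h2p c hc hpp)
  rintro d (hd | ⟨i, j, hij, hi, hj, a, b, ha, haH, hb, hbH, rfl⟩)
  · exact Submodule.subset_span hd
  · rcases Nat.lt_or_ge i 2 with hi2 | hi2
    · -- `i = 1`: `a` is algebraic by Lefschetz `(1,1)`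
      obtain rfl : i = 1 := by omega
      exact hRCH hX hB 1 j p (n - 1) k hij (by omega) hpk le_rfl hj h2p a
        (Or.inl (lefschetzOneOne_rational_holds hX a ha haH)) b hb hbH
    · -- `i ≥ 2`: `a` is a combination of representable classes (induction), and `· ∪ b` is linear
      have hik : i + (n - i) = n := by omega
      have ha' := ih i (by omega) (n - i) hik hi2 (by omega) a ha haH
      exact (Submodule.map_span_le ((cupProduct (show 2 * i + 2 * j = 2 * p by omega)).flip b) _ _).2
        (fun a' ha'mem ↦ hRCH hX hB i j p (n - i) k hij hik hpk hi hj h2p a' (Or.inr ha'mem) b hb hbH)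
        (Submodule.mem_map_of_mem ha')

end Summit.HodgeConjecture.HodgeConjecture.Theorems
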